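import Mathlib
import Summits.Ventures.PercRepro.TriangleCapDeepRows

/-!
# PercRepro — THE PAIR BOUND OF THE ROWS AND THE GENERAL DEFICIENCY LOWER BOUND (p3, gen 54; part 285)

The rows of the off-edge graph (the neighbours `y` of `w` with their non-neighbour neighbourhoods, part 280) have
pair count `Σ_{y ∈ N(w)} k(y)(k(y) − 1) = Σ_{(x, x') ∈ L², x ≠ x'} #{y : y ~ x, y ~ x'}` (the ordered pairs of a
row, counted through the pair: `sum_offDeg_nbr_mul_pred_eq`), and two non-neighbours `x ≠ x'` have at most
`min(nbrDeg x, nbrDeg x')` common neighbours in `N(w)`, NONE when `x ~ x'` (a triangle):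

  **`Σ_{y ∈ N(w)} k(y)(k(y) − 1) ≤ Σ_{(x,x') ∈ L², x ≠ x', x ≁ x'} min(nbrDeg x, nbrDeg x')`**   (`sum_offDeg_nbr_mul_pred_le`).

With the deficiency identity of part 279 this is THE GENERAL LOWER BOUND ON THE BAND VALUE for every number `ℓ` of
non-neighbours (`deficiency_lower_bound`): for every off-degree `≤ D`,

  `t(t − 1) + 2 |inside| + Σ_{x ∈ L} c(x)(D − c(x)) + (D − 1) attach ≤ 2 j + 2 t (D − 1) + Σ_{x ≠ x', x ≁ x'} min(nbrDeg x, nbrDeg x')`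

— the rows cost at least `(D − 1)` per bipartite edge minus the pair count, and the pair count is at most the
sum of the minima (the nested configuration attains it: `Σ_i C(b*_i, 2) = Σ_{x<x'} min(b_x, b_x')`).  At `|L| = 3`
this is part 281's bound (the minima over three vertices are `b_mid + 2 b_min`).  Axioms: standard.
-/

namespace PercRepro

namespace TriangleCap

namespace C047

open Finset

variable {V : Type*} [Fintype V] [DecidableEq V]

/-- The common neighbours of `x` and `x'` among the neighbours of `w`. -/
def commonNbrs (H : SimpleGraph V) [DecidableRel H.Adj] (w x x' : V) : ℕ :=
  (univ.filter (fun y => H.Adj w y ∧ H.Adj x y ∧ H.Adj x' y)).card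

omit [DecidableEq V] in
/-- `commonNbrs x x' ≤ nbrDeg x`. -/
theorem commonNbrs_le_left (H : SimpleGraph V) [DecidableRel H.Adj] (w x x' : V) :
    commonNbrs H w x x' ≤ nbrDeg H w x := by
  unfold commonNbrs nbrDeg
  apply card_le_card
  intro y hy
  rw [mem_filter] at hy ⊢
  exact ⟨hy.1, hy.2.1, hy.2.2.1⟩

omit [DecidableEq V] in
/-- `commonNbrs x x' ≤ nbrDeg x'`. -/
theorem commonNbrs_le_right (H : SimpleGraph V) [DecidableRel H.Adj] (w x x' : V) :
    commonNbrs H w x x' ≤ nbrDeg H w x' := by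
  unfold commonNbrs nbrDeg
  apply card_le_card
  intro y hy
  rw [mem_filter] at hy ⊢
  exact ⟨hy.1, hy.2.1, hy.2.2.2⟩

/-- Adjacent vertices have no common neighbour (triangle-free). -/
theorem commonNbrs_eq_zero_of_adj (H : SimpleGraph V) [DecidableRel H.Adj] (hfree : H.CliqueFree 3) (w x x' : V)
    (hxx' : H.Adj x x') : commonNbrs H w x x' = 0 := by
  unfold commonNbrs
  rw [card_eq_zero, filter_eq_empty_iff]
  intro y _ hy
  exact no_triangle H hfree hxx' hy.2.2 hy.2.1

/-- The pair count of the rows through the pairs: `Σ_{y ∈ N(w)} k(y)(k(y) − 1) = Σ_{(x,x') ∈ L.offDiag} commonNbrs x x'`. -/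
theorem sum_offDeg_nbr_mul_pred_eq (H : SimpleGraph V) [DecidableRel H.Adj] (hfree : H.CliqueFree 3) (w : V) :
    ∑ y ∈ univ.filter (fun y => H.Adj w y), offDeg H w y * (offDeg H w y - 1) =
      ∑ p ∈ (nonNbrs H w).offDiag, commonNbrs H w p.1 p.2 := by
  have h1 : ∀ y ∈ univ.filter (fun y => H.Adj w y), offDeg H w y * (offDeg H w y - 1) =
      ∑ p ∈ (nonNbrs H w).offDiag, if H.Adj y p.1 ∧ H.Adj y p.2 then 1 else 0 := by
    intro y hy
    rw [mem_filter] at hy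
    rw [offDeg_nbr_eq_card H hfree w y hy.2, Nat.mul_sub_one, ← offDiag_card]
    have : ((nonNbrs H w).filter (fun x => H.Adj y x)).offDiag =
        (nonNbrs H w).offDiag.filter (fun p : V × V => H.Adj y p.1 ∧ H.Adj y p.2) := by
      ext p
      simp only [mem_offDiag, mem_filter]
      tauto
    rw [this, card_filter]
  rw [sum_congr rfl h1, sum_comm]
  apply sum_congr rfl
  intro p _
  unfold commonNbrs
  rw [card_filter]
  rw [sum_filter]
  apply sum_congr rfl
  intro y _
  by_cases hwy : H.Adj w y
  · simp only [hwy, true_and, if_true]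
    by_cases h1 : H.Adj y p.1 <;> by_cases h2 : H.Adj y p.2 <;> simp [h1, h2, H.adj_comm]
  · simp [hwy]

/-- **THE PAIR BOUND OF THE ROWS:** `Σ_{y ∈ N(w)} k(y)(k(y) − 1) ≤ Σ_{(x,x') ∈ L.offDiag, x ≁ x'} min(nbrDeg x, nbrDeg x')`. -/
theorem sum_offDeg_nbr_mul_pred_le (H : SimpleGraph V) [DecidableRel H.Adj] (hfree : H.CliqueFree 3) (w : V) :
    ∑ y ∈ univ.filter (fun y => H.Adj w y), offDeg H w y * (offDeg H w y - 1) ≤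
      ∑ p ∈ (nonNbrs H w).offDiag.filter (fun p => ¬ H.Adj p.1 p.2), min (nbrDeg H w p.1) (nbrDeg H w p.2) := by
  rw [sum_offDeg_nbr_mul_pred_eq H hfree w, ← sum_filter_add_sum_filter_not ((nonNbrs H w).offDiag)
    (fun p : V × V => ¬ H.Adj p.1 p.2)]
  have h0 : ∑ p ∈ (nonNbrs H w).offDiag.filter (fun p : V × V => ¬ ¬ H.Adj p.1 p.2), commonNbrs H w p.1 p.2 = 0 := by
    apply sum_eq_zero
    intro p hp
    rw [mem_filter, not_not] at hp
    exact commonNbrs_eq_zero_of_adj H hfree w p.1 p.2 hp.2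
  rw [h0, add_zero]
  apply sum_le_sum
  intro p _
  exact le_min (commonNbrs_le_left H w p.1 p.2) (commonNbrs_le_right H w p.1 p.2)

/-- **THE GENERAL DEFICIENCY LOWER BOUND:** for every off-degree `≤ D`,
`t(t−1) + 2 |inside| + Σ_{x ∈ L} c(x)(D − c(x)) + (D − 1) attach ≤ 2 j + 2 t (D − 1) + Σ_{x ≠ x', x ≁ x'} min(nbrDeg x, nbrDeg x')`. -/
theorem deficiency_lower_bound (H : SimpleGraph V) [DecidableRel H.Adj] (hfree : H.CliqueFree 3) (s t j D : ℕ)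
    (hs : H.edgeFinset.card = s) (w : V) (hw : deg H w + t = s) (hw1 : 1 ≤ deg H w)
    (hj : ∑ v, deg H v * deg H v + 2 * (t * (s - t - 1)) + 2 * j = s * (s + 1))
    (hD : ∀ v, offDeg H w v ≤ D) :
    t * (t - 1) + 2 * (insideEdges H w).card + ∑ x ∈ nonNbrs H w, offDeg H w x * (D - offDeg H w x) +
      (D - 1) * attach H w ≤
      2 * j + 2 * (t * (D - 1)) +
        ∑ p ∈ (nonNbrs H w).offDiag.filter (fun p => ¬ H.Adj p.1 p.2), min (nbrDeg H w p.1) (nbrDeg H w p.2) := by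
  have hid := deficiency_identity_split H hfree s t j D hs w hw hw1 hj hD
  have hpair := sum_offDeg_nbr_mul_pred_le H hfree w
  -- the rows: `k (D − k) + k (k − 1) = (D − 1) k` for `k ≤ D`
  have hrows : ∑ y ∈ univ.filter (fun y => H.Adj w y), offDeg H w y * (D - offDeg H w y) +
      ∑ y ∈ univ.filter (fun y => H.Adj w y), offDeg H w y * (offDeg H w y - 1) = (D - 1) * attach H w := by
    unfold attach
    rw [mul_sum, ← sum_add_distrib]
    apply sum_congr rfl
    intro y _
    have hk := hD y
    have := deficiency_term (offDeg H w y) D hk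
    rcases Nat.eq_zero_or_pos D with rfl | hD1
    · have : offDeg H w y = 0 := by omega
      simp [this]
    · obtain ⟨D', rfl⟩ : ∃ D', D = D' + 1 := ⟨D - 1, by omega⟩
      rw [Nat.add_sub_cancel]
      nlinarith
  omega

end C047

end TriangleCap

end PercRepro
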